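/-
Copyright (c) 2026. All rights reserved.
Released under Apache 2.0 license as described in the file LICENSE.
Authors: abc-iut cell, statement-typer seat abc-iut-L4-t9 (wave 2, block W2-B2), discharge.
-/
import Literature.AnabelianGeometry.AbsoluteAnabelian.AbsTopIII.BiAnabelianTelecore
import Literature.AnabelianGeometry.AbsoluteAnabelian.AbsTopIII.BiAnabelianIncompatibilityProofs
import Literature.AnabelianGeometry.AbsoluteAnabelian.StrictHomotopyFamilies

/-!
# [AbsTopIII] Corollary 3.7 (iv), second incompatibility — REDUCTION to the Lemma-3.4 obstruction

S. Mochizuki, *Topics in absolute anabelian geometry III* [MochizukiAbsTopIII2015] (manuscript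
`paper:url-5493eb38cbb7`; journal pagination not held), Cor 3.7 (iv) p. 88, second sentence: "the
telecore structure `𝔗_δ` of (ii), the family of homotopies `ℋ_δ` of (ii), and the observable `𝔖†_log`
of (iii) are not simultaneously compatible"; proof p. 88 "entirely similar to" the proof of Cor 3.6
(iv) pp. 81–82 ("we obtain two mutually contradictory homotopies [...] a contradiction to Lemma 3.4").

Proof-only companion of `BiAnabelianTelecore.lean` (abc-iut-L4-t9): for EVERY setting
`𝔖 : BiAnabelianSetting X E N` and every bi-anabelian lift datum `θ`, the typed statement
`TelecoreIncompatibleStmt θ` FOLLOWS from the component-level obstruction `LogKernelObstruction`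
(`BiAnabelianIncompatibilityProofs.lean`; for the MLF setting it is Lemma 3.4 p. 74):
`telecoreIncompatibleStmt_of_obstruction`.  With `incompatibleStmt_of_obstruction` this gives
`cor_3_7_iv_of_obstruction : LogKernelObstruction → Cor_3_7_iv θ`.

The argument, run inside the axioms of ONE family of homotopies `K` on `𝒟*` (Def 3.5 (ii):
saturation, composition, whiskering) containing the pinned homotopies `θ_{□⋎}` (identity), `θ_⋎`
(from `θ_𝒳`), the telecore homotopy `[δ_⋎] ⇝ [δ_⋎]∘[π_⋎]∘[log_𝒳]∘[δ_{⋎+1}]` (identity) and the `𝔖†_log`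
homotopies `ι_×`, `ι_{log,⋎}` — all in the printed FORWARD orientation only (no inverse is assumed to
lie in `K`, which is why abc-iut-L4-t5's prefixed theorem for Cor 3.6 (iv) is not applied):
two chains of homotopies for the SAME ordered pair of paths `([λ^×]∘[δ_□], [λ^{×pf}]∘[pr_{⋎+1}]∘[δ_{⋎+1}])`
on `Γ⃗_{𝒟*}` — route 1: `ι_×`, then `θ_{□,⋎+1}` post-composed with `[λ^{×pf}]`; route 2: `θ_{□⋎}`, the
telecore homotopy, `θ_⋎`, then `ι_{log,⋎}`, each whiskered — must have equal homotopies, whence at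
every object `A` of `𝒳`: `ι_{×,A} = λ^×(α_A) ≫ ι_{log,A}` with `α_A = (θ^bi)⁻¹` an ISOMORPHISM
`A ⥲ log A`; this contradicts the obstruction (cf. `BiAnabelianSetting.LogCoreKernel`).

Technical device (general, any diagram of categories): `HomotopyFamily.strictApp` = the component
of a homotopy transported to the STRUCTURAL path functors `pathFunctor'` of abc-iut-L4-t12's
`StrictHomotopyFamilies.lean`, with its composition / whiskering / pinning rules; along explicit
paths all transports are then definitional.  Nothing here bears on [IUTchIII] Cor. 3.12.
-/

set_option autoImplicit false

namespace Literature.AnabelianGeometry.AbsoluteAnabelian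

open _root_.CategoryTheory _root_.Quiver

universe v u w

/-! ## Components of homotopies along the structural path functors (general) -/

namespace DiagramOfCategories.HomotopyFamily

variable {V : Type w} [Quiver.{v} V] {D : DiagramOfCategories.{v, u, w} V} (K : D.HomotopyFamily)

/-- Components of a natural transformation at propositionally equal objects. [folklore] -/
private theorem app_eq_of_obj_eq' {C : Type*} [Category C] {C' : Type*} [Category C']
    {F G : C ⥤ C'} (θ : F ⟶ G) {X Y : C} (h : X = Y) :
    θ.app X = eqToHom (by rw [h]) ≫ θ.app Y ≫ eqToHom (by rw [h]) := by
  subst h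
  simp

/-- Merging the `eqToHom`s of a singly nested conjugate (as in abc-iut-L4-t10's
`AutHolLogFrobeniusIncompatibility.lean`). [folklore] -/
private theorem eqToHom_sandwich' {C : Type*} [Category C] {A B₁ B₂ C₁ C₂ E : C} (p : A = B₁)
    (q : B₁ = B₂) (m : B₂ ⟶ C₁) (r : C₁ = C₂) (s : C₂ = E) :
    eqToHom p ≫ (eqToHom q ≫ m ≫ eqToHom r) ≫ eqToHom s =
      eqToHom (p.trans q) ≫ m ≫ eqToHom (r.trans s) := by
  cases p; cases q; cases r; cases s; simp

/-- The component at `x₀` of the homotopy `ζ_ϖ`, `ϖ = ([γ₁],[γ₂])`, of a family of homotopies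
(Def 3.5 (ii)), transported to the structural path functors `𝒟_[γ]` of
`StrictHomotopyFamilies.lean` (along `pathFunctor_eq_pathFunctor'`): a morphism
`𝒟_[γ₁](x₀) → 𝒟_[γ₂](x₀)` whose source and target unfold definitionally along explicit paths.
[cite: MochizukiAbsTopIII2015, Definition 3.5 (ii) p.75] -/
noncomputable def strictApp {a b : V} {p q : Path a b} (h : K.E p q) (x₀ : D.obj a) :
    (D.pathFunctor' p).obj x₀ ⟶ (D.pathFunctor' q).obj x₀ :=
  eqToHom (Functor.congr_obj (D.pathFunctor_eq_pathFunctor' p) x₀).symm ≫ (K.η h).app x₀ ≫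
    eqToHom (Functor.congr_obj (D.pathFunctor_eq_pathFunctor' q) x₀)

/-- Def 3.5 (ii), "`ζ_{ϖ''} = ζ_{ϖ'} ∘ ζ_ϖ`", on strict components.
[cite: MochizukiAbsTopIII2015, Definition 3.5 (ii) p.75] -/
theorem strictApp_trans {a b : V} {p q r : Path a b} (h₁ : K.E p q) (h₂ : K.E q r)
    (h₃ : K.E p r) (x₀ : D.obj a) : K.strictApp h₃ x₀ = K.strictApp h₁ x₀ ≫ K.strictApp h₂ x₀ := by
  have e : K.η h₃ = K.η h₁ ≫ K.η h₂ := K.η_trans h₁ h₂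
  simp [strictApp, e]

/-- Def 3.5 (ii), the whiskering axiom "`ζ = 𝒟_[γ₃] ∘ ζ_ϖ ∘ 𝒟_[γ₄]`", on strict components: the
component at `x₀` of the homotopy of `([γ₃]∘[γ₁]∘[γ₄], [γ₃]∘[γ₂]∘[γ₄])` is `𝒟_[γ₃]` applied to the
component of `ζ_ϖ` at `𝒟_[γ₄](x₀)` (up to the transports `𝒟_[γ₃∘γ∘γ₄] = 𝒟_[γ₃] ∘ 𝒟_[γ] ∘ 𝒟_[γ₄]`, which
are identities along explicit paths). [cite: MochizukiAbsTopIII2015, Definition 3.5 (ii) p.75] -/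
theorem strictApp_whisker {a b c d : V} {p q : Path a b} (h : K.E p q)
    (r₁ : Path c a) (r₂ : Path b d) (x₀ : D.obj c) :
    K.strictApp (K.isSaturated.precomp (K.isSaturated.postcomp h r₂) r₁) x₀ =
      eqToHom (by rw [D.pathFunctor'_comp_obj, D.pathFunctor'_comp_obj]) ≫
        (D.pathFunctor' r₂).map (K.strictApp h ((D.pathFunctor' r₁).obj x₀)) ≫
        eqToHom (by rw [D.pathFunctor'_comp_obj, D.pathFunctor'_comp_obj]) := by
  simp only [strictApp]
  rw [K.η_whisker h r₁ r₂]
  simp only [NatTrans.comp_app, eqToHom_app, Functor.whiskerLeft_app, Functor.whiskerRight_app,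
    Functor.congr_hom (D.pathFunctor_eq_pathFunctor' r₂),
    app_eq_of_obj_eq' (K.η h) (Functor.congr_obj (D.pathFunctor_eq_pathFunctor' r₁) x₀),
    Functor.map_comp, eqToHom_map, Category.assoc, eqToHom_trans, eqToHom_trans_assoc]
  exact eqToHom_sandwich' _ _ _ _ _

/-- A PINNED homotopy — one whose components are prescribed as `eqToHom ≫ ι ≫ eqToHom` for a natural
transformation `ι : F → G` between functors equal to the (structural) path functors — has strict
components `ι` (up to the given identifications).
[cite: MochizukiAbsTopIII2015, Definition 3.5 (ii) p.75] -/
theorem strictApp_pin {a b : V} {p q : Path a b} (h : K.E p q) {F G : D.obj a ⥤ D.obj b}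
    (hF : D.pathFunctor' p = F) (hG : D.pathFunctor' q = G) (ι : F ⟶ G)
    (hh : ∀ (x : D.obj a) (e₁ : (D.pathFunctor p).obj x = F.obj x)
      (e₂ : (D.pathFunctor q).obj x = G.obj x), (K.η h).app x = eqToHom e₁ ≫ ι.app x ≫ eqToHom e₂.symm)
    (x₀ : D.obj a) :
    K.strictApp h x₀ = eqToHom (Functor.congr_obj hF x₀) ≫ ι.app x₀ ≫
      eqToHom (Functor.congr_obj hG x₀).symm := by
  subst hF hG
  simp only [strictApp]
  rw [hh x₀ (Functor.congr_obj (D.pathFunctor_eq_pathFunctor' p) x₀)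
    (Functor.congr_obj (D.pathFunctor_eq_pathFunctor' q) x₀)]
  simp

/-- A homotopy pinned to be an IDENTITY (components `eqToHom`) has strict components `eqToHom`.
[cite: MochizukiAbsTopIII2015, Definition 3.5 (ii) p.75] -/
theorem strictApp_pinId {a b : V} {p q : Path a b} (h : K.E p q)
    (hh : ∀ (x : D.obj a) (e : (D.pathFunctor p).obj x = (D.pathFunctor q).obj x),
      (K.η h).app x = eqToHom e)
    (x₀ : D.obj a) (c : (D.pathFunctor' p).obj x₀ = (D.pathFunctor' q).obj x₀) :
    K.strictApp h x₀ = eqToHom c := by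
  simp only [strictApp]
  rw [hh x₀ (by rw [Functor.congr_obj (D.pathFunctor_eq_pathFunctor' p) x₀, c,
    Functor.congr_obj (D.pathFunctor_eq_pathFunctor' q) x₀])]
  simp

end DiagramOfCategories.HomotopyFamily

/-! ## Cor 3.7 (iv), second sentence, reduced to the Lemma-3.4 obstruction -/

namespace AbsTopIII.BiAnabelianSetting

open DiagramOfCategories

variable {X E N : Type u} [Category.{u} X] [Category.{u} E] [Category.{u} N]
  (𝔖 : BiAnabelianSetting X E N) (θ : FiberSquare.BiAnabelianLift 𝔖.gal)

/-- **Cor 3.7 (iv), second incompatibility, REDUCED to the Lemma-3.4 obstruction** (for every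
setting and every bi-anabelian lift datum `θ`): a family of homotopies on `𝒟*` containing the pinned
generators `θ_{□⋎}` (identity), `θ_⋎` (from `θ_𝒳`) of `ℋ_δ`, the telecore homotopy
`[δ_⋎] ⇝ [δ_⋎]∘[π_⋎]∘[log_𝒳]∘[δ_{⋎+1}]` of `𝔗_δ` and the homotopies `ι_×`, `ι_{log,⋎}` of `𝔖†_log` yields
"two mutually contradictory homotopies" `[λ^×]∘[δ_□] ⇝ [λ^{×pf}]∘[pr_{⋎+1}]∘[δ_{⋎+1}]` (p. 82, read for
`𝒟*`): route `ι_×` then `θ_{□,⋎+1}`, versus route `θ_{□⋎}`, telecore, `θ_⋎`, then `ι_{log,⋎}`; their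
equality says `ι_{×,A} = λ^×((θ^bi)⁻¹) ≫ ι_{log,A}` with `(θ^bi)⁻¹ : A ⥲ log(A)` an isomorphism,
contradicting the obstruction (Lemma 3.4 for the MLF setting).
[cite: MochizukiAbsTopIII2015, Cor 3.7 (iv) p.88] -/
theorem telecoreIncompatibleStmt_of_obstruction (hobs : 𝔖.LogKernelObstruction) :
    𝔖.TelecoreIncompatibleStmt θ := by
  obtain ⟨x₀, hx₀⟩ := hobs
  rintro ⟨K, ⟨hA, hG⟩, hT, ⟨hTm, hhTm⟩, hL⟩
  obtain ⟨hA0, hhA0⟩ := hA 0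
  obtain ⟨hA1, hhA1⟩ := hA (0 + 1)
  obtain ⟨hG0, hhG0⟩ := hG 0
  obtain ⟨hT0, hhT0⟩ := hT 0
  obtain ⟨hL0, hhL0⟩ := hL 0
  -- the edges of `Γ⃗_{𝒟*}` that occur (`⋎ = 0`, `⋎ + 1 = 0 + 1`)
  let d0 : (Cor37Vertex.ref ⟶ Cor37Vertex.first 0) := Cor37Edge.diag.{u} 0
  let d1 : (Cor37Vertex.ref ⟶ Cor37Vertex.first (0 + 1)) := Cor37Edge.diag.{u} (0 + 1)
  let p0 : (Cor37Vertex.first 0 ⟶ Cor37Vertex.box) := Cor37Edge.pr.{u} 0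
  let p1 : (Cor37Vertex.first (0 + 1) ⟶ Cor37Vertex.box) := Cor37Edge.pr.{u} (0 + 1)
  let lg : (Cor37Vertex.first (0 + 1) ⟶ Cor37Vertex.first 0) := Cor37Edge.log.{u} (0 + 1) 0 rfl
  let lt : (Cor37Vertex.box ⟶ Cor37Vertex.space) := Cor37Edge.lamTimes.{u}
  let lp : (Cor37Vertex.box ⟶ Cor37Vertex.space) := Cor37Edge.lamTimesPf.{u}
  -- the paths from the core vertex `𝒳` to `𝒩` visited by the two routes
  let PBt : Path Cor37Vertex.ref Cor37Vertex.space := deltaBoxPath.{u}.cons lt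
  let PBp : Path Cor37Vertex.ref Cor37Vertex.space := deltaBoxPath.{u}.cons lp
  let R : Path Cor37Vertex.ref Cor37Vertex.space := (prDeltaPath.{u} (0 + 1)).cons lp
  let Q0t : Path Cor37Vertex.ref Cor37Vertex.space := (prDeltaPath.{u} 0).cons lt
  let TPpt : Path Cor37Vertex.ref Cor37Vertex.space := ((telePath.{u} 0).cons p0).cons lt
  let L : Path Cor37Vertex.ref Cor37Vertex.space :=
    ((((Path.nil : Path Cor37Vertex.ref .ref).cons d1).cons lg).cons p0).cons lt
  -- route 1: `ι_×` behind `[δ_□]`, then `θ_{□,⋎+1}` followed by `[λ^{×pf}]`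
  have s1 : K.E PBt PBp := K.isSaturated.precomp (K.isSaturated.postcomp hTm Path.nil) deltaBoxPath.{u}
  have s2 : K.E PBp R :=
    K.isSaturated.precomp (K.isSaturated.postcomp hA1 ((Path.nil : Path Cor37Vertex.box .box).cons lp))
      Path.nil
  have r1 : K.E PBt R := K.isSaturated.trans s1 s2
  -- route 2: `θ_{□⋎}` then `[λ^×]`; telecore homotopy then `[pr_⋎]`, `[λ^×]`; `θ_⋎` whiskered; `ι_{log,⋎}`
  -- behind `[δ_{⋎+1}]`
  have s3 : K.E PBt Q0t :=
    K.isSaturated.precomp (K.isSaturated.postcomp hA0 ((Path.nil : Path Cor37Vertex.box .box).cons lt))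
      Path.nil
  have s4 : K.E Q0t TPpt :=
    K.isSaturated.precomp (K.isSaturated.postcomp hT0
      (((Path.nil : Path (Cor37Vertex.first 0) (.first 0)).cons p0).cons lt)) Path.nil
  have s5 : K.E TPpt L :=
    K.isSaturated.precomp (K.isSaturated.postcomp hG0
      (((Path.nil : Path (Cor37Vertex.first 0) (.first 0)).cons p0).cons lt))
      (((Path.nil : Path Cor37Vertex.ref .ref).cons d1).cons lg)
  have s6 : K.E L R :=
    K.isSaturated.precomp (K.isSaturated.postcomp hL0 Path.nil)
      ((Path.nil : Path Cor37Vertex.ref .ref).cons d1)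
  have t34 : K.E PBt TPpt := K.isSaturated.trans s3 s4
  have t345 : K.E PBt L := K.isSaturated.trans t34 s5
  have r2 : K.E PBt R := K.isSaturated.trans t345 s6
  -- strict components of the pinned homotopies
  have P_Tm : ∀ y : X, K.strictApp hTm y = 𝟙 _ ≫ 𝔖.iotaTimes.app y ≫ 𝟙 _ := fun y =>
    K.strictApp_pin hTm (F := 𝔖.lamTimes) (G := 𝔖.lamTimesPf) rfl rfl 𝔖.iotaTimes hhTm y
  have P_A1 : ∀ y : X, K.strictApp hA1 y = 𝟙 _ := fun y => K.strictApp_pinId hA1 hhA1 y rfl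
  have P_A0 : ∀ y : X, K.strictApp hA0 y = 𝟙 _ := fun y => K.strictApp_pinId hA0 hhA0 y rfl
  have P_T0 : ∀ y : X, K.strictApp hT0 y = 𝟙 _ := fun y => K.strictApp_pinId hT0 hhT0 y rfl
  have P_G0 : ∀ o : 𝔖.Sq, K.strictApp hG0 o = 𝟙 _ ≫ θ.thetaX.hom.app o ≫ 𝟙 _ := fun o =>
    K.strictApp_pin hG0 (F := 𝔖.proj ⋙ 𝔖.diag) (G := 𝟭 _) rfl rfl θ.thetaX.hom hhG0 o
  have P_L0 : ∀ o : 𝔖.Sq, K.strictApp hL0 o = 𝟙 _ ≫ 𝔖.iotaLogAt.app o ≫ 𝟙 _ := fun o =>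
    K.strictApp_pin hL0 (F := 𝔖.logSq ⋙ 𝔖.pr ⋙ 𝔖.lamTimes) (G := 𝔖.pr ⋙ 𝔖.lamTimesPf) rfl rfl
      𝔖.iotaLogAt (fun o e₁ e₂ => hhL0 o e₁ e₂) o
  -- strict components of the six whiskered homotopies at `x₀`
  have W1 : K.strictApp s1 x₀ = 𝟙 _ ≫ (𝟙 _ ≫ 𝔖.iotaTimes.app x₀ ≫ 𝟙 _) ≫ 𝟙 _ := by
    have := K.strictApp_whisker hTm deltaBoxPath.{u} Path.nil x₀
    rw [P_Tm] at this
    exact this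
  have W2 : K.strictApp s2 x₀ = 𝟙 _ ≫ 𝔖.lamTimesPf.map (𝟙 x₀) ≫ 𝟙 _ := by
    have := K.strictApp_whisker hA1 Path.nil ((Path.nil : Path Cor37Vertex.box .box).cons lp) x₀
    rw [P_A1] at this
    exact this
  have W3 : K.strictApp s3 x₀ = 𝟙 _ ≫ 𝔖.lamTimes.map (𝟙 x₀) ≫ 𝟙 _ := by
    have := K.strictApp_whisker hA0 Path.nil ((Path.nil : Path Cor37Vertex.box .box).cons lt) x₀
    rw [P_A0] at this
    exact this
  have W4 : K.strictApp s4 x₀ = 𝟙 _ ≫ 𝔖.lamTimes.map (𝔖.pr.map (𝟙 (𝔖.diag.obj x₀))) ≫ 𝟙 _ := by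
    have := K.strictApp_whisker hT0 Path.nil
      (((Path.nil : Path (Cor37Vertex.first 0) (.first 0)).cons p0).cons lt) x₀
    rw [P_T0] at this
    exact this
  have W5 : K.strictApp s5 x₀ = 𝟙 _ ≫
      𝔖.lamTimes.map (𝔖.pr.map (𝟙 _ ≫ θ.thetaX.hom.app (𝔖.logSq.obj (𝔖.diag.obj x₀)) ≫ 𝟙 _)) ≫
      𝟙 _ := by
    have := K.strictApp_whisker hG0 (((Path.nil : Path Cor37Vertex.ref .ref).cons d1).cons lg)
      (((Path.nil : Path (Cor37Vertex.first 0) (.first 0)).cons p0).cons lt) x₀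
    rw [P_G0] at this
    exact this
  have W6 : K.strictApp s6 x₀ = 𝟙 _ ≫ (𝟙 _ ≫ 𝔖.iotaLog.app x₀ ≫ 𝟙 _) ≫ 𝟙 _ := by
    have := K.strictApp_whisker hL0 ((Path.nil : Path Cor37Vertex.ref .ref).cons d1) Path.nil x₀
    rw [P_L0] at this
    exact this
  -- the two routes are homotopies of the same pair, hence equal
  -- (`K.strictApp r1 x₀ = K.strictApp r2 x₀` by proof irrelevance; both sides expanded by `strictApp_trans`)
  have key : K.strictApp s1 x₀ ≫ K.strictApp s2 x₀ =
      ((K.strictApp s3 x₀ ≫ K.strictApp s4 x₀) ≫ K.strictApp s5 x₀) ≫ K.strictApp s6 x₀ := by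
    rw [← K.strictApp_trans s1 s2 r1 x₀, ← K.strictApp_trans s3 s4 t34 x₀,
      ← K.strictApp_trans t34 s5 t345 x₀, ← K.strictApp_trans t345 s6 r2 x₀]
  rw [W1, W2, W3, W4, W5, W6] at key
  simp only [Category.id_comp, Category.comp_id, Functor.map_id,
    Limits.CategoricalPullback.π₁_map, FiberSquare.BiAnabelianLift.thetaX_hom_app_fst,
    Category.assoc] at key
  -- restated over the canonical objects, the remaining identities cancel
  have key' : 𝔖.iotaTimes.app x₀ ≫ 𝟙 _ = 𝟙 _ ≫
      𝔖.lamTimes.map (Limits.CategoricalPullback.Hom.fst (𝟙 (𝔖.diag.obj x₀))) ≫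
      𝔖.lamTimes.map (θ.θbi.inv.app (𝔖.logSq.obj (𝔖.diag.obj x₀))) ≫ 𝔖.iotaLog.app x₀ := key
  simp only [Category.id_comp, Category.comp_id, Functor.map_id,
    Limits.CategoricalPullback.id_fst] at key'
  -- `(θ^bi)⁻¹ : A ⥲ log A` is an isomorphism with `λ^×((θ^bi)⁻¹) ≫ ι_log = ι_×`: the obstruction
  have hiso : IsIso (θ.θbi.inv.app (𝔖.logSq.obj (𝔖.diag.obj x₀))) := inferInstance
  exact hx₀ _ hiso key'.symm

/-- **Cor 3.7 (iv)** (both incompatibilities) REDUCED to the Lemma-3.4 obstruction, for every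
setting and every bi-anabelian lift datum. [cite: MochizukiAbsTopIII2015, Cor 3.7 (iv) p.88] -/
theorem cor_3_7_iv_of_obstruction (hobs : 𝔖.LogKernelObstruction) : 𝔖.Cor_3_7_iv θ :=
  ⟨𝔖.incompatibleStmt_of_obstruction hobs, 𝔖.telecoreIncompatibleStmt_of_obstruction θ hobs⟩

end AbsTopIII.BiAnabelianSetting

end Literature.AnabelianGeometry.AbsoluteAnabelian
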